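import Summits.QuantumFields.BalabanUV.T4Continuum.Support.NE9PolydiscRateLeast

/-!
# NE9PolydiscStepOffCentreSharp — ROUTE R4♯-T, PIECE (T-a) SHARPNESS (the refuter's O-v12-1, ANSWERED YES): the interval-test
# rate `μ*(c̄, ρ₄)` of `NE9PolydiscStepOffCentre` §3 is CLASS-SHARP — a coordinate Möbius map with an attracting fixed point of
# multiplier EXACTLY `(ρ₄² − ρ²)∕(ρ₄(1 − (c̄+ρ)²))` shows that no pair `(K, μ)` with `μ < μ*` bounds every chain of the
# Schwarz–Pick class {`F : B_{ℓ^∞(A;ℂ)}(0,1) → B̄(c, ρ₄)` holomorphic, `‖c‖ ≤ c̄`}; with PART A's `isLeast_rate`,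
# `μ*` IS the least class rate (`isLeast_classRate`)

Cell `pub-balaban`, T4-DAG §2 node U3 ∕ §6 row NE9; NE9 crux team (coordinator ruling «YM REDIRECT» e34b3e0c (2)); leaf lineage
`b2b-balaban-t4-ne9-formalise-leaf-04`, generation 51.  The crux refuter's PRICING-NE9 v12 §H posed **O-v12-1**: «is the interval-test
rate μ* CLASS-SHARP for {holomorphic F : B(0,r) → B̄(c, r₄), ‖c‖ ≤ c̄} (a `not_chainLipschitz_below_offCentre` ∕ Möbius-disc witness at
the extremal ρ*)?  A YES closes the R4 rate ledger inside the Schwarz–Pick class exactly as p261103 closed R3′'s.»  THIS FILE is the YES,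
in the same style as leaf-06 generation 40's `NE9TablePolydiscSPSharp` (p261103, R3′'s constant) and the closing `example` of
leaf-03's `NE9PolydiscChain` (`f = θ·id`: no rate below `θ` in the CENTRED class — the case `c̄ = 0` here, where `μ*(0, θ) = θ`):
PART 1 §3 `norm_sub_le_of_holoChain_offCentre_unit` (leaf-03 generation 44, p260526) cannot be improved IN THE RATE on its displayed
data class — not even for ONE map iterated (an autonomous chain) with a REAL centre of norm exactly `c̄`.

THE WITNESS (one complex variable on one coordinate `β : A`).  For `ρ ∈ [0, ρ₄)` put `p := c̄ + ρ`, `q := ρ∕ρ₄ ∈ [0,1)`,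
`a := (p − q)∕(1 − pq) ∈ (−1, 1)` and `g(z) := c̄ + ρ₄·M_a(z)` with `M_a(z) = (z − a)∕(1 − az)` the disc automorphism of
`Literature.Analysis.Complex.SchwarzPickNearBoundary` (`moebius`).  Then `g : 𝔻 → B̄(c̄, ρ₄)` is holomorphic, `M_a(p) = q` so
`g(p) = p` is a FIXED POINT with `|p| = c̄ + ρ < c̄ + ρ₄ ≤ θ`, and `g′(p) = ρ₄·(1 − a²)∕(1 − ap)² = ρ₄(1 − q²)∕(1 − p²) =
(ρ₄² − ρ²)∕(ρ₄(1 − (c̄+ρ)²)) =: m(ρ)` — the Schwarz–Pick extremal value of PART 1 §2 at distance `ρ` from the centre.  Lift: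
`F(x) := g(x_β)·e_β` on `ℓ^∞(A;ℂ)` (`lp.single`), `F^[n](z·e_β) = g^[n](z)·e_β`.  A class bound `‖F^[n]x − F^[n]y‖ ≤ K·μⁿ·‖x − y‖`
on `B̄(0,θ)` gives `|(g^[n])′(p)| = m(ρ)ⁿ ≤ K·μⁿ` for all `n` (`HasDerivAt.le_of_lip'`), hence `m(ρ) ≤ μ`: `μ` PASSES THE INTERVAL
TEST at every `ρ`, i.e. `μ` is admissible, i.e. `μ ≥ μ*(c̄, ρ₄)` by PART A.

HONEST FRAMING (T4-DAG PAGE 1).  Rung (B)+1 of the FINITE-VOLUME T⁴ programme — NOT infinite volume, NOT a mass gap, NOT the Clay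
problem.  NE9 (`T4OutputRate.NE9` ∧ `FadingMemory`) is a cell NEW ESTIMATE, NOT PRINTED in [I] = CMP **109**, [II] = CMP **116**, NOT
PROVED for Bałaban's `E^{(j)}` («NE9 ⇐ the named binders»; row WALLED ON A MODEL O-NE9-1; spine PROVED 0∕9).  A class-sharpness
witness for a RATE inside a CONDITIONAL END says NOTHING about the estimate itself; it only closes «can the (T-a) chain lemma be
improved on the same displayed data» (no — further rate gains on R4♯-T need NEW DATA about the slices, cf. T15 on R3′'s side, not a
better lemma).  HONEST DEPENDENCY (cell line, verbatim): continuum YM on T⁴ ⇐ BetaPertH ∧ nine spine estimates (0/9 proved); BetaPertH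
⇐ (D1) ∧ (D4) ∧ CAP+tail; G-an2-4 gates asym, D1 and NE2/3/4.  `FlowStep.BetaPertH`, (B), (B^μ) do not occur; nothing of [I]∕[II] is
used, even for types.

CONTENT ([folklore]; 0 def, 0 Prop-valued definition, 0 sorry):
* §1 `moebius_ofReal`, `moebiusDeriv_ofReal` — `M_a` and `M_a′` at real `a`, `v` are the reals `(v − a)∕(1 − av)`, `(1 − a²)∕(1 − av)²`.
* §2 `differentiableOn_affMoebius`, `mapsTo_affMoebius`, `affMoebius_apply_ofReal`, `hasDerivAt_affMoebius` — the map `c̄ + ρ₄·M_a`.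
* §3 `param_abs_lt_one`, `param_moebius_apply`, `param_deriv` — the parameter `a = (p − q)∕(1 − pq)`.
* §4 `hasDerivAt_iterate_fixedPt`, **`norm_le_of_chainBound_fixedPt`** — an autonomous chain bound `K·μⁿ` on `B̄(0,θ)` bounds the
  multiplier at an interior fixed point: `|g′(p)| ≤ μ`.
* §5 `scalar_chainBound_of_linfty` — the one-coordinate lift `F(x) = g(x_β)·e_β` carries the class bound down to `g`.
* §6 **`rateIneq_of_classChainBound`** — a class rate passes the interval test; **`leastRate_le_of_classChainBound`** — hence `μ* ≤ μ`.
* §7 `classChainBound_at_leastRate` — conversely PART 1 §3 bounds EVERY (even non-autonomous) chain of the class at `(1∕(1−θ²), μ*)`;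
  **`isLeast_classRate`** — `IsLeast {μ | ∃ K, every autonomous chain of the class is K·μⁿ-Lipschitz on B̄(0,θ)} μ*(c̄, ρ₄)`.
DISGUISE TEST: one-variable complex analysis (a Möbius map with a fixed point) on one coordinate of `ℓ^∞(A;ℂ)`; no cluster expansion,
no history, nothing of Bałaban's; not NE9.  WHAT THIS DOES NOT DO: nothing about Bałaban's activities (which may carry more structure
than the class displays), the coupling half, the model O-NE9-1, the prefactor `1∕(1−θ²)` or the displays `z`, `S`.

References: [FV1980] T. Franzoni, E. Vesentini, *Holomorphic Maps and Invariant Distances*, North-Holland Math. Studies 40 (1980), ch. V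
(Schwarz–Pick on the polydisc; the automorphisms `M_a`); [Harris1979] L. A. Harris, North-Holland Math. Studies 34 (1979) 345–406.  TYPES ∕
loci only; nothing asserted.  Summits-side NEW work (LEAN PLACEMENT RULE); imports PART A `NE9PolydiscRateLeast` (hence PART 1, leaf-03's
`NE9PolydiscSchwarzPick.hasDerivAt_moebius` and the Literature Möbius map) BY NAME; modifies nothing; 0 sorry.
-/

noncomputable section

namespace Summit.QuantumFields.BalabanUV.T4Continuum.NE9PolydiscStepOffCentreSharp

open Metric Set Filter Function
open scoped Topology ComplexConjugate ENNReal
open Literature.Analysis.Complex.SchwarzPick (moebius norm_moebius_le differentiableOn_moebius)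
open Summit.QuantumFields.BalabanUV.T4Continuum.NE9PolydiscSchwarzPick (hasDerivAt_moebius norm_coordFn_le)
open Summit.QuantumFields.BalabanUV.T4Continuum.NE9PolydiscStepOffCentre (norm_sub_le_of_holoChain_offCentre_unit)
open Summit.QuantumFields.BalabanUV.T4Continuum.NE9PolydiscRateLeast (isLeast_rate)

variable {A : Type*}

/-! ## §1 The Möbius map at real parameters -/

/-- A real number of absolute value `< 1` is a point of the unit disc. [folklore] -/
theorem norm_ofReal_lt_one {a : ℝ} (ha : |a| < 1) : ‖(a : ℂ)‖ < 1 := by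
  rwa [Complex.norm_real, Real.norm_eq_abs]

/-- `M_a(v) = (v − a)∕(1 − av)` for REAL `a`, `v` (a real number). [folklore] -/
theorem moebius_ofReal (a v : ℝ) : moebius (a : ℂ) (v : ℂ) = (((v - a) / (1 - a * v) : ℝ) : ℂ) := by
  unfold moebius
  rw [Complex.conj_ofReal]
  push_cast
  rfl

/-- The derivative value of `NE9PolydiscSchwarzPick.hasDerivAt_moebius` at REAL `a`, `v`: `(1 − a²)∕(1 − av)²`. [folklore] -/
theorem moebiusDeriv_ofReal (a v : ℝ) :
    (1 - conj (a : ℂ) * (a : ℂ)) / (1 - conj (a : ℂ) * (v : ℂ)) ^ 2 = (((1 - a ^ 2) / (1 - a * v) ^ 2 : ℝ) : ℂ) := by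
  rw [Complex.conj_ofReal]
  push_cast
  ring

/-! ## §2 The affine Möbius map `z ↦ c̄ + ρ₄·M_a(z)` -/

/-- `z ↦ c̄ + ρ₄·M_a(z)` is holomorphic on the unit disc (`|a| < 1`). [folklore] -/
theorem differentiableOn_affMoebius {a : ℝ} (ha : |a| < 1) (cbar ρ₄ : ℝ) :
    DifferentiableOn ℂ (fun z : ℂ => (cbar : ℂ) + (ρ₄ : ℂ) * moebius (a : ℂ) z) (ball 0 1) :=
  ((differentiableOn_moebius (norm_ofReal_lt_one ha)).const_mul _).const_add _

/-- `z ↦ c̄ + ρ₄·M_a(z)` maps the unit disc into `B̄(c̄, ρ₄)` (`|a| < 1`, `0 ≤ ρ₄`; `|M_a| ≤ 1`). [folklore] -/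
theorem mapsTo_affMoebius {a : ℝ} (ha : |a| < 1) (cbar : ℝ) {ρ₄ : ℝ} (hρ₄ : 0 ≤ ρ₄) :
    MapsTo (fun z : ℂ => (cbar : ℂ) + (ρ₄ : ℂ) * moebius (a : ℂ) z) (ball 0 1) (closedBall (cbar : ℂ) ρ₄) := by
  intro z hz
  have hz' : ‖z‖ < 1 := mem_ball_zero_iff.1 hz
  rw [mem_closedBall, dist_eq_norm, add_sub_cancel_left, norm_mul, Complex.norm_of_nonneg hρ₄]
  exact mul_le_of_le_one_right hρ₄ (norm_moebius_le (norm_ofReal_lt_one ha) hz')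

/-- The value of `c̄ + ρ₄·M_a` at a REAL point `v`: the real number `c̄ + ρ₄(v − a)∕(1 − av)`. [folklore] -/
theorem affMoebius_apply_ofReal (a v cbar ρ₄ : ℝ) :
    (fun z : ℂ => (cbar : ℂ) + (ρ₄ : ℂ) * moebius (a : ℂ) z) (v : ℂ) =
      ((cbar + ρ₄ * ((v - a) / (1 - a * v)) : ℝ) : ℂ) := by
  simp only [moebius_ofReal]
  push_cast
  ring

/-- The derivative of `c̄ + ρ₄·M_a` at a REAL point `v` of the disc: `ρ₄(1 − a²)∕(1 − av)²`. [folklore] -/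
theorem hasDerivAt_affMoebius {a v : ℝ} (ha : |a| < 1) (hv : |v| < 1) (cbar ρ₄ : ℝ) :
    HasDerivAt (fun z : ℂ => (cbar : ℂ) + (ρ₄ : ℂ) * moebius (a : ℂ) z)
      ((ρ₄ * ((1 - a ^ 2) / (1 - a * v) ^ 2) : ℝ) : ℂ) (v : ℂ) := by
  have h := ((hasDerivAt_moebius (norm_ofReal_lt_one ha) (norm_ofReal_lt_one hv)).const_mul (ρ₄ : ℂ)).const_add
    (cbar : ℂ)
  refine h.congr_deriv ?_
  rw [moebiusDeriv_ofReal]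
  push_cast
  ring

/-! ## §3 The parameter `a = (p − q)∕(1 − pq)`: `|a| < 1`, `M_a(p) = q`, `M_a′(p) = (1 − q²)∕(1 − p²)` -/

/-- `1 − pq > 0` for `p ∈ [0,1)`, `q < 1`. [folklore] -/
theorem one_sub_mul_pos {p q : ℝ} (hp0 : 0 ≤ p) (hp1 : p < 1) (hq1 : q < 1) : 0 < 1 - p * q := by
  nlinarith [mul_le_mul_of_nonneg_left hq1.le hp0]

/-- For `p, q ∈ [0,1)` the Möbius parameter `a = (p − q)∕(1 − pq)` lies in `(−1, 1)`. [folklore] -/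
theorem param_abs_lt_one {p q : ℝ} (hp0 : 0 ≤ p) (hp1 : p < 1) (hq0 : 0 ≤ q) (hq1 : q < 1) :
    |(p - q) / (1 - p * q)| < 1 := by
  have hpq := one_sub_mul_pos hp0 hp1 hq1
  rw [abs_div, abs_of_pos hpq, div_lt_one hpq, abs_lt]
  constructor <;> nlinarith [mul_nonneg hp0 hq0]

/-- The subtraction formula: with `a = (p − q)∕(1 − pq)`, `M_a(p) = (p − a)∕(1 − ap) = q`. [folklore] -/
theorem param_moebius_apply {p q : ℝ} (hp0 : 0 ≤ p) (hp1 : p < 1) (hq1 : q < 1) :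
    (p - (p - q) / (1 - p * q)) / (1 - (p - q) / (1 - p * q) * p) = q := by
  have hpq := (one_sub_mul_pos hp0 hp1 hq1).ne'
  have h1p : (1 : ℝ) - p ^ 2 ≠ 0 := by nlinarith
  have hnum : p - (p - q) / (1 - p * q) = q * (1 - p ^ 2) / (1 - p * q) := by
    field_simp
    ring
  have hden : 1 - (p - q) / (1 - p * q) * p = (1 - p ^ 2) / (1 - p * q) := by
    field_simp
    ring
  rw [hnum, hden]
  rw [div_div_div_cancel_right₀ hpq]
  rw [mul_div_assoc]
  rw [div_self h1p]
  rw [mul_one]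

/-- With `a = (p − q)∕(1 − pq)`: `M_a′(p) = (1 − a²)∕(1 − ap)² = (1 − q²)∕(1 − p²)` — the Schwarz–Pick EQUALITY
`|M_a′(p)|(1 − p²) = 1 − |M_a(p)|²` of a disc automorphism, at real letters. [folklore] -/
theorem param_deriv {p q : ℝ} (hp0 : 0 ≤ p) (hp1 : p < 1) (hq1 : q < 1) :
    (1 - ((p - q) / (1 - p * q)) ^ 2) / (1 - (p - q) / (1 - p * q) * p) ^ 2 = (1 - q ^ 2) / (1 - p ^ 2) := by
  have hpq := (one_sub_mul_pos hp0 hp1 hq1).ne'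
  have h1p : (1 : ℝ) - p ^ 2 ≠ 0 := by nlinarith
  have hnum : 1 - ((p - q) / (1 - p * q)) ^ 2 = (1 - p ^ 2) * (1 - q ^ 2) / (1 - p * q) ^ 2 := by
    field_simp
    ring
  have hden : (1 - (p - q) / (1 - p * q) * p) ^ 2 = (1 - p ^ 2) ^ 2 / (1 - p * q) ^ 2 := by
    field_simp
    ring
  rw [hnum, hden, div_div_div_cancel_right₀ (pow_ne_zero 2 hpq)]
  field_simp

/-! ## §4 From an autonomous chain bound to the multiplier at an interior fixed point -/

/-- At a fixed point `p` of `g` with `g′(p) = d`: `(g^[n])′(p) = dⁿ` (chain rule). [folklore] -/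
theorem hasDerivAt_iterate_fixedPt {g : ℂ → ℂ} {p d : ℂ} (hder : HasDerivAt g d p) (hfix : g p = p) :
    ∀ n : ℕ, HasDerivAt g^[n] (d ^ n) p
  | 0 => by simpa using hasDerivAt_id p
  | n + 1 => by
    have ih := hasDerivAt_iterate_fixedPt hder hfix n
    have hg' : HasDerivAt g d (g^[n] p) := by rw [Function.iterate_fixed hfix n]; exact hder
    have h := hg'.comp p ih
    rw [Function.iterate_succ', pow_succ']
    exact h

/-- **MULTIPLIER BOUND.**  If the iterates of `g : ℂ → ℂ` satisfy `‖g^[n] x − g^[n] y‖ ≤ K·μⁿ·‖x − y‖` on `B̄(0,θ)` for all `n`,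
and `p` with `|p| < θ` is a fixed point with `g′(p) = d`, then `|d| ≤ μ`: `|d|ⁿ = |(g^[n])′(p)| ≤ K·μⁿ` for all `n`
(`HasDerivAt.le_of_lip'` on the neighbourhood `B̄(0,θ)` of `p`), and a geometric sequence dominated by another has the smaller
ratio. [folklore] -/
theorem norm_le_of_chainBound_fixedPt {g : ℂ → ℂ} {p d : ℂ} {θ K μ : ℝ} (hθ : 0 < θ) (hp : ‖p‖ < θ)
    (hfix : g p = p) (hder : HasDerivAt g d p)
    (hbound : ∀ n : ℕ, ∀ x ∈ closedBall (0 : ℂ) θ, ∀ y ∈ closedBall (0 : ℂ) θ,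
      ‖g^[n] x - g^[n] y‖ ≤ K * μ ^ n * ‖x - y‖) :
    ‖d‖ ≤ μ := by
  have hpθ : p ∈ closedBall (0 : ℂ) θ := mem_closedBall_zero_iff.2 hp.le
  have hKn : ∀ n : ℕ, 0 ≤ K * μ ^ n := fun n => by
    have hθm : ((θ : ℝ) : ℂ) ∈ closedBall (0 : ℂ) θ := by
      rw [mem_closedBall_zero_iff, Complex.norm_of_nonneg hθ.le]
    have h0m : (0 : ℂ) ∈ closedBall (0 : ℂ) θ := mem_closedBall_self hθ.le
    have h := hbound n _ hθm _ h0m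
    rw [sub_zero, Complex.norm_of_nonneg hθ.le] at h
    have h' : 0 * θ ≤ K * μ ^ n * θ := le_trans (by simp) ((norm_nonneg _).trans h)
    exact le_of_mul_le_mul_right h' hθ
  have hle : ∀ n : ℕ, ‖d‖ ^ n ≤ K * μ ^ n := fun n => by
    have hdn : HasDerivAt g^[n] (d ^ n) p := hasDerivAt_iterate_fixedPt hder hfix n
    have hnhds : closedBall (0 : ℂ) θ ∈ 𝓝 p :=
      mem_of_superset (isOpen_ball.mem_nhds (mem_ball_zero_iff.2 hp)) ball_subset_closedBall
    have hlip : ∀ᶠ x in 𝓝 p, ‖g^[n] x - g^[n] p‖ ≤ K * μ ^ n * ‖x - p‖ := by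
      filter_upwards [hnhds] with x hx using hbound n x hx p hpθ
    have := hdn.le_of_lip' (hKn n) hlip
    rwa [norm_pow] at this
  by_contra h
  push Not at h
  have hK1 : 1 ≤ K := by simpa using hle 0
  have hμ0 : 0 < μ := by
    have h1 := hle 1
    rw [pow_one, pow_one] at h1
    by_contra hμ
    push Not at hμ
    nlinarith [norm_nonneg d]
  have hr : 1 < ‖d‖ / μ := (one_lt_div hμ0).2 h
  have hrn : ∀ n : ℕ, (‖d‖ / μ) ^ n ≤ K := fun n => by
    rw [div_pow, div_le_iff₀ (pow_pos hμ0 n)]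
    exact hle n
  obtain ⟨n, hn⟩ := ((tendsto_pow_atTop_atTop_of_one_lt hr).eventually_gt_atTop K).exists
  exact absurd (hrn n) (not_le.2 hn)

/-! ## §5 One coordinate of `ℓ^∞(A;ℂ)`: lifting a scalar map and descending the class bound -/

/-- **ONE-COORDINATE LIFT.**  For `g : 𝔻 → B̄(c₀, ρ₄)` holomorphic with `|c₀| ≤ c̄`, the map `F(x) := g(x_β)·e_β` of `ℓ^∞(A;ℂ)`
is holomorphic on the unit ball into `B̄(c₀e_β, ρ₄)` with `‖c₀e_β‖ ≤ c̄`, and `F^[n](z·e_β) = g^[n](z)·e_β`; so a bound valid for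
every autonomous chain of the class {`F : B(0,1) → B̄(c, ρ₄)` holomorphic, `‖c‖ ≤ c̄`} on `B̄(0,θ)` holds for the iterates of `g` on
`B̄_ℂ(0,θ)`. [folklore] -/
theorem scalar_chainBound_of_linfty [DecidableEq A] (β : A) {g : ℂ → ℂ} {c₀ : ℂ} {cbar ρ₄ θ K μ : ℝ}
    (hg : DifferentiableOn ℂ g (ball 0 1)) (hgm : MapsTo g (ball 0 1) (closedBall c₀ ρ₄)) (hc₀ : ‖c₀‖ ≤ cbar)
    (hclass : ∀ (F : lp (fun _ : A => ℂ) ∞ → lp (fun _ : A => ℂ) ∞) (c : lp (fun _ : A => ℂ) ∞),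
      DifferentiableOn ℂ F (ball 0 1) → MapsTo F (ball 0 1) (closedBall c ρ₄) → ‖c‖ ≤ cbar →
      ∀ n : ℕ, ∀ x ∈ closedBall (0 : lp (fun _ : A => ℂ) ∞) θ, ∀ y ∈ closedBall (0 : lp (fun _ : A => ℂ) ∞) θ,
        ‖F^[n] x - F^[n] y‖ ≤ K * μ ^ n * ‖x - y‖) :
    ∀ n : ℕ, ∀ z ∈ closedBall (0 : ℂ) θ, ∀ w ∈ closedBall (0 : ℂ) θ, ‖g^[n] z - g^[n] w‖ ≤ K * μ ^ n * ‖z - w‖ := by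
  set ι : ℂ →L[ℂ] lp (fun _ : A => ℂ) ∞ := lp.singleContinuousLinearMap ℂ (fun _ : A => ℂ) ∞ β with hι
  have hιn : ∀ z : ℂ, ‖ι z‖ = ‖z‖ := fun z => by
    rw [hι, lp.singleContinuousLinearMap_apply, lp.norm_single (by simp)]
  have hιβ : ∀ z : ℂ, (ι z) β = z := fun z => by
    rw [hι, lp.singleContinuousLinearMap_apply, lp.single_apply_self]
  set F : lp (fun _ : A => ℂ) ∞ → lp (fun _ : A => ℂ) ∞ := fun x => ι (g (x β)) with hF
  have hcoord : ∀ x : lp (fun _ : A => ℂ) ∞, x ∈ ball (0 : lp (fun _ : A => ℂ) ∞) 1 → x β ∈ ball (0 : ℂ) 1 :=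
    fun x hx => by
      rw [mem_ball_zero_iff] at hx ⊢
      exact lt_of_le_of_lt (norm_coordFn_le x β) hx
  have hFd : DifferentiableOn ℂ F (ball 0 1) := by
    intro x hx
    have h1 : DifferentiableAt ℂ g (x β) := hg.differentiableAt (isOpen_ball.mem_nhds (hcoord x hx))
    have h2 : DifferentiableAt ℂ (fun y : lp (fun _ : A => ℂ) ∞ => y β) x :=
      (lp.evalCLM ℂ (fun _ : A => ℂ) ∞ β).differentiableAt
    exact (ι.differentiableAt.comp x (h1.comp x h2)).differentiableWithinAt
  have hFm : MapsTo F (ball 0 1) (closedBall (ι c₀) ρ₄) := by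
    intro x hx
    have h := hgm (hcoord x hx)
    rw [mem_closedBall, dist_eq_norm] at h ⊢
    rw [hF]
    dsimp only
    rw [← map_sub, hιn]
    exact h
  have hc : ‖ι c₀‖ ≤ cbar := by rw [hιn]; exact hc₀
  have hiter : ∀ (n : ℕ) (z : ℂ), F^[n] (ι z) = ι (g^[n] z) := by
    intro n
    induction n with
    | zero => intro z; rfl
    | succ n ih =>
      intro z
      rw [iterate_succ_apply, iterate_succ_apply, ← ih]
      congr 1
      rw [hF]
      dsimp only
      rw [hιβ]
  intro n z hz w hw
  have hz' : ι z ∈ closedBall (0 : lp (fun _ : A => ℂ) ∞) θ := by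
    rw [mem_closedBall_zero_iff, hιn]; exact mem_closedBall_zero_iff.1 hz
  have hw' : ι w ∈ closedBall (0 : lp (fun _ : A => ℂ) ∞) θ := by
    rw [mem_closedBall_zero_iff, hιn]; exact mem_closedBall_zero_iff.1 hw
  have h := hclass F (ι c₀) hFd hFm hc n (ι z) hz' (ι w) hw'
  rwa [hiter, hiter, ← map_sub, hιn, ← map_sub, hιn] at h

/-! ## §6 MAIN: a class rate passes the interval test, hence is at least `μ*` -/

/-- **O-v12-1 (YES): A CLASS RATE IS ADMISSIBLE.**  Let `0 ≤ c̄`, `0 < ρ₄`, `c̄ + ρ₄ ≤ θ < 1`, `β : A`.  If ONE pair `(K, μ)`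
bounds every AUTONOMOUS chain of the Schwarz–Pick class — for every `F : B_{ℓ^∞(A;ℂ)}(0,1) → B̄(c, ρ₄)` holomorphic with `‖c‖ ≤ c̄`,
`‖F^[n] x − F^[n] y‖ ≤ K·μⁿ·‖x − y‖` on `B̄(0,θ)` for all `n` — then `μ` satisfies PART 1's RATE INEQUALITY
`ρ₄² − ρ² ≤ μ·ρ₄·(1 − (c̄+ρ)²)` for every `ρ ∈ [0, ρ₄]`.  Witness at `ρ < ρ₄`: the coordinate Möbius map `F(x) = (c̄ + ρ₄M_a(x_β))e_β`,
`a = (p − q)∕(1 − pq)`, `p = c̄ + ρ`, `q = ρ∕ρ₄`, with fixed point `pe_β` of multiplier `(ρ₄² − ρ²)∕(ρ₄(1 − p²))` (§2–§5); the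
endpoint `ρ = ρ₄` from `μ > 0` (the case `ρ = 0`). [folklore; FV1980 ch. V] -/
theorem rateIneq_of_classChainBound [DecidableEq A] (β : A) {θ cbar ρ₄ K μ : ℝ} (hcbar : 0 ≤ cbar) (hρ₄ : 0 < ρ₄)
    (hθ : cbar + ρ₄ ≤ θ) (hθ1 : θ < 1)
    (hclass : ∀ (F : lp (fun _ : A => ℂ) ∞ → lp (fun _ : A => ℂ) ∞) (c : lp (fun _ : A => ℂ) ∞),
      DifferentiableOn ℂ F (ball 0 1) → MapsTo F (ball 0 1) (closedBall c ρ₄) → ‖c‖ ≤ cbar →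
      ∀ n : ℕ, ∀ x ∈ closedBall (0 : lp (fun _ : A => ℂ) ∞) θ, ∀ y ∈ closedBall (0 : lp (fun _ : A => ℂ) ∞) θ,
        ‖F^[n] x - F^[n] y‖ ≤ K * μ ^ n * ‖x - y‖) :
    ∀ ρ ∈ Icc (0 : ℝ) ρ₄, ρ₄ ^ 2 - ρ ^ 2 ≤ μ * ρ₄ * (1 - (cbar + ρ) ^ 2) := by
  have hθ0 : 0 < θ := lt_of_lt_of_le (lt_of_lt_of_le hρ₄ (by linarith)) hθ
  have key : ∀ ρ : ℝ, 0 ≤ ρ → ρ < ρ₄ → ρ₄ ^ 2 - ρ ^ 2 ≤ μ * ρ₄ * (1 - (cbar + ρ) ^ 2) := by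
    intro ρ hρ0 hρ1
    set p : ℝ := cbar + ρ with hp
    set q : ℝ := ρ / ρ₄ with hq
    have hp0 : 0 ≤ p := by rw [hp]; linarith
    have hpθ : p < θ := by rw [hp]; linarith
    have hp1 : p < 1 := hpθ.trans hθ1
    have hq0 : 0 ≤ q := div_nonneg hρ0 hρ₄.le
    have hq1 : q < 1 := (div_lt_one hρ₄).2 hρ1
    set a : ℝ := (p - q) / (1 - p * q) with ha
    have ha1 : |a| < 1 := param_abs_lt_one hp0 hp1 hq0 hq1
    have hpabs : |p| < 1 := by rw [abs_of_nonneg hp0]; exact hp1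
    set g : ℂ → ℂ := fun z => (cbar : ℂ) + (ρ₄ : ℂ) * moebius (a : ℂ) z with hg
    have hfix : g (p : ℂ) = (p : ℂ) := by
      rw [hg, affMoebius_apply_ofReal, ha, param_moebius_apply hp0 hp1 hq1]
      rw [hq]
      rw [mul_div_cancel₀ _ hρ₄.ne']
    set m : ℝ := ρ₄ * ((1 - a ^ 2) / (1 - a * p) ^ 2) with hm
    have hder : HasDerivAt g (m : ℂ) (p : ℂ) := hasDerivAt_affMoebius ha1 hpabs cbar ρ₄
    have h1p : 0 < 1 - p ^ 2 := by nlinarith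
    have hmval : m = (ρ₄ ^ 2 - ρ ^ 2) / (ρ₄ * (1 - p ^ 2)) := by
      rw [hm, ha, param_deriv hp0 hp1 hq1, hq]
      field_simp
    have hm0 : 0 ≤ m := by
      rw [hmval]; exact div_nonneg (by nlinarith) (mul_pos hρ₄ h1p).le
    have hgb := scalar_chainBound_of_linfty β (differentiableOn_affMoebius ha1 cbar ρ₄)
      (mapsTo_affMoebius ha1 cbar hρ₄.le) (by rw [Complex.norm_of_nonneg hcbar]) hclass
    have hnp : ‖(p : ℂ)‖ < θ := by rw [Complex.norm_of_nonneg hp0]; exact hpθ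
    have hle := norm_le_of_chainBound_fixedPt hθ0 hnp hfix hder hgb
    rw [Complex.norm_of_nonneg hm0, hmval, div_le_iff₀ (mul_pos hρ₄ h1p)] at hle
    calc ρ₄ ^ 2 - ρ ^ 2 ≤ μ * (ρ₄ * (1 - p ^ 2)) := hle
      _ = μ * ρ₄ * (1 - (cbar + ρ) ^ 2) := by rw [hp]; ring
  intro ρ hρ
  rcases hρ.2.lt_or_eq with hlt | heq
  · exact key ρ hρ.1 hlt
  · have h0 := key 0 le_rfl hρ₄
    simp only [add_zero] at h0
    have h1c : 0 < 1 - cbar ^ 2 := by nlinarith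
    have hμ : 0 ≤ μ := by
      by_contra hμ
      push Not at hμ
      nlinarith [mul_pos hρ₄ h1c, pow_pos hρ₄ 2]
    rw [heq]
    have : 0 ≤ 1 - (cbar + ρ₄) ^ 2 := by nlinarith
    nlinarith [mul_nonneg (mul_nonneg hμ hρ₄.le) this]

/-- **COROLLARY: `μ* ≤ μ`.**  Under the hypotheses of `rateIneq_of_classChainBound`, the class rate `μ` is at least the least
admissible rate `μ*(c̄, ρ₄) = ((1 − c̄² + ρ₄²) − √(((1−ρ₄)² − c̄²)((1+ρ₄)² − c̄²))) ∕ (2ρ₄)` of PART A's `isLeast_rate`. [folklore] -/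
theorem leastRate_le_of_classChainBound [DecidableEq A] (β : A) {θ cbar ρ₄ K μ : ℝ} (hcbar : 0 ≤ cbar) (hρ₄ : 0 < ρ₄)
    (hθ : cbar + ρ₄ ≤ θ) (hθ1 : θ < 1)
    (hclass : ∀ (F : lp (fun _ : A => ℂ) ∞ → lp (fun _ : A => ℂ) ∞) (c : lp (fun _ : A => ℂ) ∞),
      DifferentiableOn ℂ F (ball 0 1) → MapsTo F (ball 0 1) (closedBall c ρ₄) → ‖c‖ ≤ cbar →
      ∀ n : ℕ, ∀ x ∈ closedBall (0 : lp (fun _ : A => ℂ) ∞) θ, ∀ y ∈ closedBall (0 : lp (fun _ : A => ℂ) ∞) θ,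
        ‖F^[n] x - F^[n] y‖ ≤ K * μ ^ n * ‖x - y‖) :
    (1 - cbar ^ 2 + ρ₄ ^ 2 - Real.sqrt (((1 - ρ₄) ^ 2 - cbar ^ 2) * ((1 + ρ₄) ^ 2 - cbar ^ 2))) / (2 * ρ₄) ≤ μ :=
  (isLeast_rate hρ₄ hcbar (lt_of_le_of_lt hθ hθ1)).2 (rateIneq_of_classChainBound β hcbar hρ₄ hθ hθ1 hclass)

/-! ## §7 The least class rate IS `μ*` -/

/-- CONVERSELY, PART 1 §3 AT THE LEAST RATE: every chain of the class (even NON-autonomous, centres `c n` with `‖c n‖ ≤ c̄`) is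
`(1∕(1−θ²))·μ*ⁿ`-Lipschitz on `B̄(0,θ)` — `norm_sub_le_of_holoChain_offCentre_unit` fed with `isLeast_rate`'s membership half. [folklore] -/
theorem classChainBound_at_leastRate {θ cbar ρ₄ : ℝ} (hcbar : 0 ≤ cbar) (hρ₄ : 0 < ρ₄) (hθ : cbar + ρ₄ ≤ θ)
    (hθ1 : θ < 1)
    {f : ℕ → lp (fun _ : A => ℂ) ∞ → lp (fun _ : A => ℂ) ∞}
    (hfd : ∀ n, DifferentiableOn ℂ (f n) (ball (0 : lp (fun _ : A => ℂ) ∞) 1))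
    {c : ℕ → lp (fun _ : A => ℂ) ∞}
    (hfm : ∀ n, MapsTo (f n) (ball (0 : lp (fun _ : A => ℂ) ∞) 1) (closedBall (c n) ρ₄))
    (hc : ∀ n, ‖c n‖ ≤ cbar)
    {T : ℕ → lp (fun _ : A => ℂ) ∞ → lp (fun _ : A => ℂ) ∞} (hT0 : T 0 = id)
    (hT : ∀ n, T (n + 1) = f n ∘ T n) (n : ℕ) {x y : lp (fun _ : A => ℂ) ∞}
    (hx : x ∈ closedBall (0 : lp (fun _ : A => ℂ) ∞) θ) (hy : y ∈ closedBall (0 : lp (fun _ : A => ℂ) ∞) θ) :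
    ‖T n x - T n y‖ ≤ 1 / (1 - θ ^ 2) *
      ((1 - cbar ^ 2 + ρ₄ ^ 2 - Real.sqrt (((1 - ρ₄) ^ 2 - cbar ^ 2) * ((1 + ρ₄) ^ 2 - cbar ^ 2))) / (2 * ρ₄)) ^ n *
        ‖x - y‖ :=
  norm_sub_le_of_holoChain_offCentre_unit hρ₄ hθ hθ1 (isLeast_rate hρ₄ hcbar (lt_of_le_of_lt hθ hθ1)).1 hfd hfm hc hT0 hT n
    hx hy

/-- **THE LEAST CLASS RATE IS `μ*(c̄, ρ₄)`** (O-v12-1 in one line).  For `0 ≤ c̄`, `0 < ρ₄`, `c̄ + ρ₄ ≤ θ < 1` and a coordinate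
`β : A`, the set of rates `μ` for which SOME prefactor `K` makes every autonomous chain of the Schwarz–Pick class
{`F : B_{ℓ^∞(A;ℂ)}(0,1) → B̄(c, ρ₄)` holomorphic, `‖c‖ ≤ c̄`} `K·μⁿ`-Lipschitz on `B̄(0,θ)` has LEAST element
`μ*(c̄, ρ₄) = ((1 − c̄² + ρ₄²) − √(((1−ρ₄)² − c̄²)((1+ρ₄)² − c̄²))) ∕ (2ρ₄)`: membership by §7's first theorem at `K = 1∕(1−θ²)`,
minimality by §6.  (The R4♯-T rate ledger is closed inside the class, as p261103 closed R3′'s constant.) [folklore; FV1980 ch. V] -/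
theorem isLeast_classRate [DecidableEq A] (β : A) {θ cbar ρ₄ : ℝ} (hcbar : 0 ≤ cbar) (hρ₄ : 0 < ρ₄) (hθ : cbar + ρ₄ ≤ θ)
    (hθ1 : θ < 1) :
    IsLeast {μ : ℝ | ∃ K : ℝ, ∀ (F : lp (fun _ : A => ℂ) ∞ → lp (fun _ : A => ℂ) ∞) (c : lp (fun _ : A => ℂ) ∞),
        DifferentiableOn ℂ F (ball 0 1) → MapsTo F (ball 0 1) (closedBall c ρ₄) → ‖c‖ ≤ cbar →
        ∀ n : ℕ, ∀ x ∈ closedBall (0 : lp (fun _ : A => ℂ) ∞) θ, ∀ y ∈ closedBall (0 : lp (fun _ : A => ℂ) ∞) θ,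
          ‖F^[n] x - F^[n] y‖ ≤ K * μ ^ n * ‖x - y‖}
      ((1 - cbar ^ 2 + ρ₄ ^ 2 - Real.sqrt (((1 - ρ₄) ^ 2 - cbar ^ 2) * ((1 + ρ₄) ^ 2 - cbar ^ 2))) / (2 * ρ₄)) := by
  constructor
  · refine ⟨1 / (1 - θ ^ 2), fun F c hFd hFm hc n x hx y hy => ?_⟩
    exact classChainBound_at_leastRate hcbar hρ₄ hθ hθ1 (f := fun _ => F) (fun _ => hFd) (c := fun _ => c) (fun _ => hFm)
      (fun _ => hc) (T := fun n => F^[n]) (Function.iterate_zero F) (fun n => Function.iterate_succ' (f := F) n) n hx hy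
  · rintro μ ⟨K, hK⟩
    exact leastRate_le_of_classChainBound β hcbar hρ₄ hθ hθ1 hK

end Summit.QuantumFields.BalabanUV.T4Continuum.NE9PolydiscStepOffCentreSharp

end
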